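import Summits.QuantumFields.YangMills.Theses.SmallCircleAnchor

/-!
# Abelianisation toolkit for crux `AnchorGap`: the electric term as a commutator norm, and the
# Polyakov line in the static gauge

Helpers for crux stmt-QuantumFields-11141 (`AnchorGap`, route `SmallCircleAnchor`), line
independent (tree-level input of `stub_abelianisation`):

* `electric_term_re_trace` (registered sub-goal): for a unitary lattice representation `r` and
  `a, b ∈ G`, `Re tr r(a b a⁻¹ b⁻¹) = N − ½ Re tr((AB − BA)(AB − BA)ᴴ)` with `A = r(a)`, `B = r(b)`:
  the electric plaquette with holonomy `a` penalises exactly the non-commutativity of the spatial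
  link with the holonomy (W-boson mass term; maximal iff `r(b)` commutes with `r(a)`).
* `re_trace_mul_conjTranspose_nonneg`: `0 ≤ Re tr(M Mᴴ)`, hence `Re tr r(a b a⁻¹ b⁻¹) ≤ N`.
* `polyakov_kill`: in the static gauge (`kill`: time-like links outside the top layer set to `1`)
  the Polyakov line above `x` is the single top-layer link `U ((-1, x), none)`.
-/

set_option autoImplicit false

noncomputable section

namespace Summit.QuantumFields.YangMills.Theorems.AnchorGap

open MeasureTheory Matrix
open Literature.MathematicalPhysics.QuantumFieldTheory

namespace Toolkit

/-- `0 ≤ Re tr (M Mᴴ)` (it is `Σ |M i j|²`). [folklore] -/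
theorem re_trace_mul_conjTranspose_nonneg {n : ℕ} (M : Matrix (Fin n) (Fin n) ℂ) :
    0 ≤ ((M * Mᴴ).trace).re := by
  rw [Matrix.trace, Complex.re_sum]
  refine Finset.sum_nonneg fun i _ => ?_
  rw [Matrix.diag_apply, Matrix.mul_apply, Complex.re_sum]
  refine Finset.sum_nonneg fun j _ => ?_
  rw [Matrix.conjTranspose_apply, Complex.mul_re, Complex.star_def, Complex.conj_re, Complex.conj_im]
  nlinarith [sq_nonneg (M i j).re, sq_nonneg (M i j).im]

/-- For a unitary lattice representation, `r(g⁻¹) = r(g)ᴴ`. [folklore] -/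
theorem rep_inv_eq_conjTranspose {G : Type} [Group G] [TopologicalSpace G] (r : LatticeRep G)
    (g : G) : r.ρ g⁻¹ = (r.ρ g)ᴴ := by
  have hu := r.mem_unitary g
  rw [Matrix.mem_unitaryGroup_iff'] at hu
  -- hu : star (r.ρ g) * r.ρ g = 1
  have hinv : r.ρ g * r.ρ g⁻¹ = 1 := by rw [← map_mul, mul_inv_cancel, map_one]
  calc r.ρ g⁻¹ = (star (r.ρ g) * r.ρ g) * r.ρ g⁻¹ := by rw [hu, one_mul]
    _ = star (r.ρ g) * (r.ρ g * r.ρ g⁻¹) := by rw [mul_assoc]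
    _ = (r.ρ g)ᴴ := by rw [hinv, mul_one, Matrix.star_eq_conjTranspose]

/-- **The electric term is a commutator norm** (registered sub-goal of crux `AnchorGap`; tree-level
abelianisation): for a unitary lattice representation `r` and all `a b : G`,
`Re tr r(a b a⁻¹ b⁻¹) = N − ½ Re tr((r a · r b − r b · r a)(r a · r b − r b · r a)ᴴ)`. Proof:
`r(a⁻¹) = r(a)ᴴ`, expand the product using `r(a) r(a)ᴴ = 1 = r(b) r(b)ᴴ`, and
`tr((ABAᴴBᴴ)ᴴ) = conj tr(ABAᴴBᴴ)`. [folklore] -/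
theorem electric_term_re_trace :
    ∀ (G : Type) [Group G] [TopologicalSpace G] (r : LatticeRep G) (a b : G), ((r.ρ (a * b * a⁻¹ * b⁻¹)).trace).re = r.N - (1 / 2) * (((r.ρ a * r.ρ b - r.ρ b * r.ρ a) * (r.ρ a * r.ρ b - r.ρ b * r.ρ a)ᴴ).trace).re := by
  intro G _ _ r a b
  set A := r.ρ a with hA
  set B := r.ρ b with hB
  have hAu : A * Aᴴ = 1 := by
    have := r.mem_unitary a
    rw [Matrix.mem_unitaryGroup_iff] at this
    simpa [Matrix.star_eq_conjTranspose] using this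
  have hBu : B * Bᴴ = 1 := by
    have := r.mem_unitary b
    rw [Matrix.mem_unitaryGroup_iff] at this
    simpa [Matrix.star_eq_conjTranspose] using this
  have hprod : r.ρ (a * b * a⁻¹ * b⁻¹) = A * B * Aᴴ * Bᴴ := by
    rw [map_mul, map_mul, map_mul, rep_inv_eq_conjTranspose, rep_inv_eq_conjTranspose]
  have hexp : (A * B - B * A) * (A * B - B * A)ᴴ =
      1 + 1 - (A * B * Aᴴ * Bᴴ + (A * B * Aᴴ * Bᴴ)ᴴ) := by
    rw [Matrix.conjTranspose_sub, Matrix.conjTranspose_mul, Matrix.conjTranspose_mul,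
      Matrix.conjTranspose_mul, Matrix.conjTranspose_mul, Matrix.conjTranspose_mul,
      Matrix.conjTranspose_conjTranspose, Matrix.conjTranspose_conjTranspose]
    have h1 : A * B * (Bᴴ * Aᴴ) = 1 := by
      rw [← mul_assoc, mul_assoc A, hBu, mul_one, hAu]
    have h2 : B * A * (Aᴴ * Bᴴ) = 1 := by
      rw [← mul_assoc, mul_assoc B, hAu, mul_one, hBu]
    rw [sub_mul, mul_sub, mul_sub, h1, h2]
    noncomm_ring
  have htr : (((A * B * Aᴴ * Bᴴ)ᴴ).trace).re = ((A * B * Aᴴ * Bᴴ).trace).re := by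
    rw [Matrix.trace_conjTranspose, Complex.star_def, Complex.conj_re]
  have h1tr : ((1 : Matrix (Fin r.N) (Fin r.N) ℂ).trace).re = r.N := by
    rw [Matrix.trace_one]; simp
  rw [hprod, hexp, Matrix.trace_sub, Matrix.trace_add, Matrix.trace_add, Complex.sub_re,
    Complex.add_re, Complex.add_re, htr, h1tr]
  ring

/-- **Upper bound of the electric term**: `Re tr r(a b a⁻¹ b⁻¹) ≤ N`, with equality iff `r(a)`
and `r(b)` commute (by `electric_term_re_trace`). [folklore] -/
theorem electric_term_le (G : Type) [Group G] [TopologicalSpace G] (r : LatticeRep G) (a b : G) :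
    ((r.ρ (a * b * a⁻¹ * b⁻¹)).trace).re ≤ r.N := by
  rw [electric_term_re_trace G r a b]
  have := re_trace_mul_conjTranspose_nonneg (r.ρ a * r.ρ b - r.ρ b * r.ρ a)
  linarith

/-- **The Polyakov line in the static gauge** (crux `AnchorGap` vocabulary): after `kill` (every
time-like link `((t, x), none)` with `t + 1 ≠ 0` set to `1`) the ordered product of the `T`
time-like links above `x` is the single top-layer link `U ((-1, x), none)`. [folklore] -/
theorem polyakov_kill :
    ∀ (G : Type) [Group G] (T : ℕ) [NeZero T] (L : ℕ), let St := ZMod T × (Fin 3 → ZMod L); let Cfg := St × Option (Fin 3) → G; let P : Cfg → (Fin 3 → ZMod L) → G := fun U x => (List.ofFn fun t : Fin T => U ((((t : ℕ) : ZMod T), x), none)).prod; let kill : Cfg → Cfg := fun U p => if p.2 = none ∧ p.1.1 + 1 ≠ 0 then 1 else U p; ∀ (U : Cfg) (x : Fin 3 → ZMod L), P (kill U) x = U ((-1, x), none) := by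
  intro G _ T _ L St Cfg P kill U x
  obtain ⟨T', rfl⟩ : ∃ T', T = T' + 1 := ⟨T - 1, (Nat.sub_add_cancel NeZero.one_le).symm⟩
  show (List.ofFn fun t : Fin (T' + 1) => kill U ((((t : ℕ) : ZMod (T' + 1)), x), none)).prod =
    U ((-1, x), none)
  rw [List.ofFn_succ', List.concat_eq_append, List.prod_append, List.prod_singleton]
  have hlast : (((Fin.last T' : Fin (T' + 1)) : ℕ) : ZMod (T' + 1)) + 1 = 0 := by
    rw [Fin.val_last]
    have : (((T' : ℕ) : ZMod (T' + 1)) + 1) = ((T' + 1 : ℕ) : ZMod (T' + 1)) := by push_cast; ring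
    rw [this, ZMod.natCast_self]
  have hlast' : (((Fin.last T' : Fin (T' + 1)) : ℕ) : ZMod (T' + 1)) = -1 :=
    eq_neg_of_add_eq_zero_left hlast
  have hinit : (List.ofFn fun i : Fin T' =>
      kill U ((((i.castSucc : ℕ) : ZMod (T' + 1)), x), none)).prod = 1 := by
    apply List.prod_eq_one
    intro g hg
    rw [List.mem_ofFn] at hg
    obtain ⟨i, rfl⟩ := hg
    have hne : (((i.castSucc : Fin (T' + 1)) : ℕ) : ZMod (T' + 1)) + 1 ≠ 0 := by
      rw [Fin.val_castSucc]
      have h1 : (((i : ℕ) : ZMod (T' + 1)) + 1) = ((i + 1 : ℕ) : ZMod (T' + 1)) := by push_cast; ring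
      rw [h1, Ne, ZMod.natCast_eq_zero_iff]
      intro hd
      have := Nat.eq_zero_of_dvd_of_lt hd (by omega)
      omega
    show (if (none : Option (Fin 3)) = none ∧ _ then (1 : G) else _) = 1
    rw [if_pos ⟨rfl, hne⟩]
  rw [hinit, one_mul]
  show (if (none : Option (Fin 3)) = none ∧ _ then (1 : G) else _) = _
  rw [if_neg (fun h => h.2 hlast), hlast']

end Toolkit

end Summit.QuantumFields.YangMills.Theorems.AnchorGap

end
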